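import Summits.BirchSwinnertonDyer.Rank1Residual.X11a.SelmerCompanionTateLineRelIndex
import Summits.BirchSwinnertonDyer.Rank1Residual.X11a.SelmerCompanionSplitStrict
import Literature.NumberTheory.EllipticCurves.LocalUnramifiedTwoCocycle
import HarnessLib

/-!
# Route (3e) SELMER COMPANION, XXXV: SHAPE G — `BSD(A,p) ⟹ BSD(E,p)` across a full-torsion level-raising place
# (class X11a = N7; cell `b2b-bsdres`, unit `b2b-bsdres-x11a`, gen 31)

HONEST FRAMING (run/shared/lean/b2b/bsd-rank1-residual/, verbatim in every file): the goal of the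
cell is to DELETE the COMBINATION-SHAPED residual classes of the Birch–Swinnerton-Dyer formula for
ALL analytic-rank `≤ 1` elliptic curves over `ℚ` — "full BSD formula for every rank `≤ 1` curve in
class `C`" assembled STRICTLY from published theorems — so that the rank-`≤ 1` remainder becomes
exactly the CONSTRUCTION-SHAPED classes, which are TYPED (missing-input `Prop`s), NOT attempted.
This is not "finishing BSD". CLASS-OWNERS.md: research routes; NO CLAIM BEYOND STATED CLASSES.
THEOREMS ONLY; nothing booked; no label moves. CONDITIONAL on the PUBLISHED binders GZK (`hGZK`),
Cassels–Tate (`hCT`), Tate's local Euler characteristic (`hEP`, Milne *ADT* I Thm. 2.8), and on the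
per-pair data named (Tate datum of `E` at `ℓ` = A40, Silverman *ATAEC* V.3.1/V.5.3; certificates).

## What this file proves

* `bsdp_of_bsdp_partner_of_tateLine_certificates` — **SHAPE G**: `E = W` of analytic rank `0`,
  `E[p]` irreducible, `p ∤ #Ш_an(E)`, `p` odd; `A` CLOSED at `p` (`BSD(A,p)`) of analytic rank `1`
  with `p ∤ #Ш_an(A)`, `A[p]` irreducible (so `#Sel^(p)(A) = p`, file II); `θ : E[p] ≃ A[p]` (C1);
  `S ⊇ T ∌ v₀`, `v₀ ∤ p`, with agreement (`hagree`: kind (i) or any kind lemma) off `T ∪ {v₀}`; at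
  `v₀`: the Tate datum of `E`, `p ∣ q_{v₀} − 1` (`hq`, giving `μ_p ⊂ ℚ_{v₀}`), the Kummer point `hpt`, and the strictness certificate of file
  XXXII for a rational point `g ∈ A(ℚ)` (`hcert`); budget `p · ∏_{v∈T} #E(ℚ_v)[p]·#(ℤ_v/p) ≤ p`.
  Then `BSD(E,p)` (`natCard_selmerGroup_le_of_congr_of_le_off_insert_strict`, file XX, with
  `m = p` from lemma G1 (file XXXIV) and `hstrict` from file XXXII; Cassels–Tate parity, file II).

Per-pair inputs of record (census v9 §3 (B), five N7 cells @3): BSD(A,p) (ledger), C1, the place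
kinds, the Tate datum (A40), `ℓ ≡ 1 (mod p)` (`hq`), and the two finite certificates (PARI kit
j144468/j144748, 29/29 STRICT; the Kummer point = a rational point of `A(ℚ_ℓ)` whose class points
along `Λ̃`). Not a class theorem; nothing booked.

References: [MazurRubin2004] §2.3; [MilneADT2006] I Thm. 2.8; [SilvermanATAEC1994] V.3.1, V.5.3,
IV Rem. 9.6; [Miller2011LMS] Def. 1.1; files II, XIII, XX, XXXI–XXXIV; HOME/b2b-bsdres-x11a/REPORT-g31.md.
-/

set_option autoImplicit false

noncomputable section

open scoped Classical NNReal

open WeierstrassCurve Literature.NumberTheory.EllipticCurves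
  Literature.NumberTheory.GaloisRepresentations Field NumberField IsDedekindDomain
  IsDedekindDomain.HeightOneSpectrum
  Literature.NumberTheory.EllipticCurves.Rank1Residual
  Literature.NumberTheory.EllipticCurves.Rank1Residual.Typed

namespace Summit.BirchSwinnertonDyer.Rank1Residual.X11a.SelmerCompanion

variable (W A : WeierstrassCurve ℚ) [W.IsElliptic] [A.IsElliptic] (p : ℕ) [hp : Fact p.Prime]

/-- **`μ_p ⊂ ℚ_v` when `v ∤ p` and `p ∣ q_v − 1`**: every `σ ∈ Γ_{ℚ_v}` fixes every `p`-th root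
of unity of `K̄_v`. An arithmetic Frobenius acts on roots of unity of order prime to the residue
characteristic by the `q_v`-th power (`frobenius_smul_eq_pow_of_pow_eq_one`), which is the identity
on `μ_p` as `q_v ≡ 1 (mod p)`; the inertia group fixes them (`smul_eq_self_of_mem_inertia_of_pow_eq_one`);
the stabiliser is open (`isOpen_stabilizer_of_pow_eq_one`), so it is all of `Γ_{ℚ_v}`
(`eq_top_of_isOpen_of_frobenius_mem_of_inertia_le`). Discharges the hypothesis `hμ` of lemma G1.
[cite: SerreLocalFields1979, Ch. IV §4 Prop. 16] [cite: NeukirchANT1999, Ch. II §9 Prop. (9.9)–(9.11)] -/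
theorem units_map_eq_self_of_pow_eq_one_of_dvd {v : HeightOneSpectrum (𝓞 ℚ)}
    (hpv : (p : 𝓞 ℚ) ∉ v.asIdeal)
    (hq : p ∣ Nat.card (IsLocalRing.ResidueField (v.adicCompletionIntegers ℚ)) - 1)
    (σ : absoluteGaloisGroup (v.adicCompletion ℚ)) (ζ : (AlgebraicClosure (v.adicCompletion ℚ))ˣ)
    (hζ : ζ ^ p = 1) :
    Units.map (absoluteGaloisGroup.toAlgEquiv _ σ : AlgebraicClosure (v.adicCompletion ℚ) →*
      AlgebraicClosure (v.adicCompletion ℚ)) ζ = ζ := by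
  have hpp : p.Prime := hp.out
  obtain ⟨w, hw⟩ := v.exists_spectralValuation
  obtain ⟨𝔐, h𝔐⟩ := v.localPrimesAbove_nonempty
  obtain ⟨F, hF⟩ := v.exists_isArithFrobAt_localAbsIntegers h𝔐
  have hwp : w (p : AlgebraicClosure (v.adicCompletion ℚ)) = 1 := by
    have h := spectralValuation_intCast_eq_one hw (n := (p : ℤ)) (by rwa [Int.cast_natCast])
    rwa [Int.cast_natCast] at h
  have hζ' : (ζ : AlgebraicClosure (v.adicCompletion ℚ)) ^ p = 1 := by
    rw [← Units.val_pow_eq_pow_val, hζ, Units.val_one]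
  have hFζ : F • (ζ : AlgebraicClosure (v.adicCompletion ℚ)) = ζ := by
    rw [frobenius_smul_eq_pow_of_pow_eq_one hw h𝔐 hF hpp.ne_zero hwp hζ']
    obtain ⟨d, hd⟩ := hq
    have h2 := two_le_natCard_residueField (K := ℚ) (v := v)
    have h1 : Nat.card (IsLocalRing.ResidueField (v.adicCompletionIntegers ℚ)) = p * d + 1 := by
      omega
    rw [h1, pow_succ, pow_mul, hζ', one_pow, one_mul]
  have hIζ : ∀ τ ∈ 𝔐.inertia (absoluteGaloisGroup (v.adicCompletion ℚ)),
      τ • (ζ : AlgebraicClosure (v.adicCompletion ℚ)) = ζ :=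
    fun τ hτ ↦ smul_eq_self_of_mem_inertia_of_pow_eq_one hw h𝔐 hτ hpp.ne_zero hwp hζ'
  set U : Subgroup (absoluteGaloisGroup (v.adicCompletion ℚ)) :=
    MulAction.stabilizer (absoluteGaloisGroup (v.adicCompletion ℚ))
      (ζ : AlgebraicClosure (v.adicCompletion ℚ)) with hU
  have hUtop : U = ⊤ :=
    v.eq_top_of_isOpen_of_frobenius_mem_of_inertia_le h𝔐 hF
      (isOpen_stabilizer_of_pow_eq_one v hpp.ne_zero hζ')
      ((MulAction.mem_stabilizer_iff).mpr hFζ)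
      (fun τ hτ ↦ (MulAction.mem_stabilizer_iff).mpr (hIζ τ hτ))
  have hσ : σ • (ζ : AlgebraicClosure (v.adicCompletion ℚ)) = ζ :=
    (MulAction.mem_stabilizer_iff).mp (show σ ∈ U by rw [hUtop]; trivial)
  exact Units.ext hσ

/-- **SHAPE G — `BSD(A,p) ⟹ BSD(E,p)` across a full-torsion level-raising place.** `p` odd;
`E = W` of analytic rank `0`, `E[p]` irreducible, `p ∤ #Ш_an(E)`; `A` CLOSED at `p` (`BSD(A,p)`),
analytic rank `1`, `p ∤ #Ш_an(A)`, `A[p]` irreducible (so `#Sel^(p)(A/ℚ) = p`, file II);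
`θ : E[p] ≃ A[p]` (C1); finite sets `T ⊆ S`, both curves good and `v ∤ p` outside `S`; a place
`v₀ ∈ S \ T`, `v₀ ∤ p`, carrying: an equivariant Tate datum `Φ'` of `E` (A40), `μ_p ⊂ ℚ_{v₀}`
(`hq`: `p ∣ q_{v₀} − 1`), a Kummer point along the transported Tate line (`hpt`) and the strictness certificate of
file XXXII for a rational point `g ∈ A(ℚ)` (`hcert`); agreement (`hagree`) at `S \ (T ∪ {v₀})`;
budget `p · ∏_{v∈T} #E(ℚ_v)[p]·#(ℤ_v/p) ≤ p`. Then `BSD(E,p)`. Binders GZK, Cassels–Tate, Milne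
I.2.8 (`hEP` at `v₀`). Not a class theorem; nothing booked.
[cite: MazurRubin2004, §2.3] [cite: Miller2011LMS, §1 and Def. 1.1]
[cite: MilneADT2006, Ch. I §2 Thm. 2.8] [cite: SilvermanATAEC1994, Ch. V Thm. 3.1, Thm. 5.3] -/
theorem bsdp_of_bsdp_partner_of_tateLine_certificates
    (hGZK : rank_eq_analyticRank_of_analyticRank_le_one)
    (hCT : exists_casselsTate_pairing (K := ℚ)) (hp2 : p ≠ 2)
    (hr : W.analyticRank = 0) (hirr : Irr W p) (hSha : X11a.ShaAnUnit W p)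
    (hbsdA : BSDp A p) (hrA : A.analyticRank = 1) (hirrA : Irr A p) (hShaA : X11a.ShaAnUnit A p)
    (hn : (p : ℤ) ≠ 0)
    (θ : geomTorsion W (p : ℤ) ≃+ geomTorsion A (p : ℤ))
    (hθ : ∀ (σ : absoluteGaloisGroup ℚ) (P : geomTorsion W (p : ℤ)), θ (σ • P) = σ • θ P)
    (S T : Finset (HeightOneSpectrum (𝓞 ℚ))) (hTS : T ⊆ S)
    (hS : ∀ v : HeightOneSpectrum (𝓞 ℚ), v ∉ S →
      A.HasGoodReductionAt v ∧ W.HasGoodReductionAt v ∧ (p : 𝓞 ℚ) ∉ v.asIdeal)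
    {v₀ : HeightOneSpectrum (𝓞 ℚ)} (hpv₀ : (p : 𝓞 ℚ) ∉ v₀.asIdeal) (hv₀S : v₀ ∈ S) (hv₀T : v₀ ∉ T)
    (hEP : localEulerPoincareCharacteristic (v₀.adicCompletion ℚ))
    (hagree : ∀ v ∈ S, v ∉ T → v ≠ v₀ →
      ((p : 𝓞 ℚ) ∉ v.asIdeal ∧ Nat.card (nsmulAddMonoidHom p :
          (W.baseChange (v.adicCompletion ℚ)).toAffine.Point →+ _).ker = 1) ∨
      (∀ c ∈ selmerLocalKer W (v.adicCompletion ℚ) (p : ℤ),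
        h1Equiv θ hθ c ∈ selmerLocalKer A (v.adicCompletion ℚ) (p : ℤ)))
    (Φ' : Additive (AlgebraicClosure (v₀.adicCompletion ℚ))ˣ →+ localPoints W (v₀.adicCompletion ℚ))
    (hequiv' : ∀ (σ : absoluteGaloisGroup (v₀.adicCompletion ℚ))
        (u : (AlgebraicClosure (v₀.adicCompletion ℚ))ˣ),
      σ • Φ' (Additive.ofMul u) = Φ' (Additive.ofMul (Units.map
        (absoluteGaloisGroup.toAlgEquiv _ σ : AlgebraicClosure (v₀.adicCompletion ℚ) →*
          AlgebraicClosure (v₀.adicCompletion ℚ)) u)))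
    (hrat' : ∀ P : localPoints W (v₀.adicCompletion ℚ),
      (∀ σ : absoluteGaloisGroup (v₀.adicCompletion ℚ), σ • P = P) →
      ∃ u : (v₀.adicCompletion ℚ)ˣ, Φ' (Additive.ofMul (Units.map (algebraMap (v₀.adicCompletion ℚ)
        (AlgebraicClosure (v₀.adicCompletion ℚ)) : v₀.adicCompletion ℚ →*
          AlgebraicClosure (v₀.adicCompletion ℚ)) u)) = P)
    (hq : p ∣ Nat.card (IsLocalRing.ResidueField (v₀.adicCompletionIntegers ℚ)) - 1)
    (hpt : ∃ h : localPoints A (v₀.adicCompletion ℚ),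
      (∀ σ : absoluteGaloisGroup (v₀.adicCompletion ℚ),
        ∃ (ζ : (AlgebraicClosure (v₀.adicCompletion ℚ))ˣ) (_ : ζ ^ p = 1)
          (hζ : Φ' (Additive.ofMul ζ) ∈
            AddSubgroup.torsionBy (localPoints W (v₀.adicCompletion ℚ)) (p : ℤ)),
          σ • h - h = pointsMap A (v₀.adicCompletion ℚ)
            ((θ ((W.torsionPointsEquiv (p : ℤ) (E := v₀.adicCompletion ℚ) hn).symm
              ⟨Φ' (Additive.ofMul ζ), hζ⟩) : geomTorsion A (p : ℤ)) : geomPoints A)) ∧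
      ∃ σ₁ : absoluteGaloisGroup (v₀.adicCompletion ℚ), σ₁ • h ≠ h)
    (g : A.toAffine.Point)
    (hcert : ∀ c : localPoints A (v₀.adicCompletion ℚ),
      (p : ℤ) • c = pointsMap A (v₀.adicCompletion ℚ) (toGeomPoints A g) →
      ∃ σ : absoluteGaloisGroup (v₀.adicCompletion ℚ),
        ∀ (ζ : (AlgebraicClosure (v₀.adicCompletion ℚ))ˣ), ζ ^ p = 1 →
        ∀ hζ : Φ' (Additive.ofMul ζ) ∈
            AddSubgroup.torsionBy (localPoints W (v₀.adicCompletion ℚ)) (p : ℤ),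
          σ • c - c ≠ pointsMap A (v₀.adicCompletion ℚ)
            ((θ ((W.torsionPointsEquiv (p : ℤ) (E := v₀.adicCompletion ℚ) hn).symm
              ⟨Φ' (Additive.ofMul ζ), hζ⟩) : geomTorsion A (p : ℤ)) : geomPoints A))
    (hbudget : p * ∏ v ∈ T, (Nat.card (nsmulAddMonoidHom p :
        (W.baseChange (v.adicCompletion ℚ)).toAffine.Point →+ _).ker *
          Nat.card (v.adicCompletionIntegers ℚ ⧸
            Ideal.span {(p : v.adicCompletionIntegers ℚ)})) ≤ p) :
    BSDp W p := by
  have hpp : p.Prime := hp.out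
  classical
  -- `#Sel^(p)(A) = p` for the closed rank-one partner
  have hSel : Nat.card (A.selmerGroup (p : ℤ)) = p := by
    rw [natCard_selmerGroup_eq_pow_of_bsdp A p hbsdA hShaA hirrA, hrA, pow_one]
  -- the Kummer class of a `p`-th root `Q` of `g` lies in `Sel^(p)(A)`
  have hdiv : ∀ P : geomPoints A, ∃ Q : geomPoints A, (p : ℤ) • Q = P :=
    fun P ↦ A.zsmul_geomPoints_surjective_of_charZero hn P
  have hs : kummerClassTorsion A (p : ℤ) (zsmulRoot A (p : ℤ) hdiv g)
      (zsmul_zsmulRoot_mem A (p : ℤ) hdiv g) ∈ A.selmerGroup (p : ℤ) := by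
    have h : kummerMapTorsion A (p : ℤ) hdiv g ∈ A.selmerGroup (p : ℤ) :=
      (mem_selmerGroup_iff A _ _).mpr
        ⟨fun v ↦ kummerMapTorsion_mem_selmerLocalKer A (p : ℤ) hdiv (v.adicCompletion ℚ) g,
          fun w' ↦ kummerMapTorsion_mem_selmerLocalKer A (p : ℤ) hdiv w'.Completion g⟩
    rw [kummerMapTorsion_apply] at h
    exact h
  -- enlarge `T` by the places of kind (i) (they cost `#𝓛_v = 1`)
  set T' := T ∪ S.filter (fun v ↦ (p : 𝓞 ℚ) ∉ v.asIdeal ∧ Nat.card (nsmulAddMonoidHom p :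
      (W.baseChange (v.adicCompletion ℚ)).toAffine.Point →+ _).ker = 1 ∧ v ≠ v₀) with hT'
  have hT'S : T' ⊆ S := Finset.union_subset hTS (Finset.filter_subset _ _)
  have hv₀T' : v₀ ∉ T' := by
    rw [hT', Finset.mem_union, Finset.mem_filter, not_or]
    exact ⟨hv₀T, fun h ↦ h.2.2.2 rfl⟩
  have hle := natCard_selmerGroup_le_of_congr_of_le_off_insert_strict A W hp2 θ hθ S T' hv₀S
    hv₀T' hT'S hS (fun v hv hvT hvv₀ c hc ↦ ?_)
    (relIndex_map_selmerLocalKer_le_of_tateLine W A p hEP hpv₀ hn θ hθ Φ' hequiv' hrat'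
      (units_map_eq_self_of_pow_eq_one_of_dvd p hpv₀ hq) hpt)
    (fun c hc hsel ↦ h1Equiv_eq_zero_of_selmer_of_tateLine_certificate A v₀ W hn θ hθ Φ'
      hequiv' hrat' hSel (zsmul_zsmulRoot_mem A (p : ℤ) hdiv g) hs
      (fun c' hc' ↦ hcert c' (by rw [hc', zsmul_zsmulRoot])) hc hsel)
  · refine bsdp_of_natCard_selmerGroup_le W p hGZK hCT hr hirr hSha (le_trans hle ?_)
    refine le_trans (le_of_eq ?_) hbudget
    congr 1
    have hsplit' : T' = T ∪ (S.filter (fun v ↦ (p : 𝓞 ℚ) ∉ v.asIdeal ∧ Nat.card (nsmulAddMonoidHom p :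
      (W.baseChange (v.adicCompletion ℚ)).toAffine.Point →+ _).ker = 1 ∧ v ≠ v₀) \ T) := by
      rw [hT', Finset.union_sdiff_self_eq_union]
    rw [hsplit', Finset.prod_union Finset.disjoint_sdiff,
      Finset.prod_eq_one (s := _ \ T) (fun v hv ↦ ?_), mul_one]
    · refine Finset.prod_congr rfl fun v _ ↦ ?_
      exact W.natCard_kummerLocalConditionAt_adicCompletion v hpp.ne_zero
    · rw [Finset.mem_sdiff, Finset.mem_filter] at hv
      rw [W.natCard_kummerLocalConditionAt_adicCompletion v hpp.ne_zero, hv.1.2.2.1, one_mul,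
        natCard_quot_adicCompletionIntegers_eq_one hv.1.2.1]
  · have hvT0 : v ∉ T := fun h ↦ hvT (Finset.mem_union_left _ h)
    rcases hagree v hv hvT0 hvv₀ with h1 | h2
    · exact absurd (Finset.mem_union_right _ (Finset.mem_filter.mpr ⟨hv, h1.1, h1.2, hvv₀⟩)) hvT
    · exact h2 c hc

end Summit.BirchSwinnertonDyer.Rank1Residual.X11a.SelmerCompanion

end
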